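import Literature.NumberTheory.PAdicHodge.BmaxPlus
import Literature.NumberTheory.PAdicHodge.AinfLog
import Literature.NumberTheory.GaloisRepresentations.InertiaPadicCharacterProofs
import Mathlib.RingTheory.AdicCompletion.Algebra
import HarnessLib

/-!
# `t = log [ε] ∈ B_max⁺(F)`: the `p`-adic construction

Continuation of `BmaxPlus`.  Let `u = [ε] − 1 = ξ·w ∈ 𝔸_inf` (`uAinf`, `xi_dvd_uAinf`) and
`ω = ξ/p ∈ B⁰_max = 𝔸_inf[ξ/p]`.  The terms of Fontaine's `t = log [ε] = Σ_{k≥1} (−1)^{k+1} u^k/k` are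
`u^k/k = c_k · w^k · ω^k` with `c_k = p^k/k ∈ ℤ_p`, and `c_k → 0` `p`-adically
(`v_p(c_k) = k − v_p(k) ≥ k/2`), so the partial sums form a `p`-adic Cauchy sequence in `B⁰_max` and
`t` is an element of the `p`-adic completion `B_max⁺` (Berger 2002, §1.2: "la série qui définit
`log([ε])` converge"; here in Colmez's `B_max⁺` rather than in `B_dR⁺`, cf. tree `BdRPlusLog.tBdR`).

* `logCoeff p k = c_k ∈ ℤ_p` with `k · c_k = p^k` (`natCast_mul_logCoeff`; units of `ℤ_p` prime to `p` from
  `PadicCharacter.isUnit_natCast_of_not_dvd`), and `c_k ∈ p^n ℤ_p`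
  for `2n ≤ k` (`exists_logCoeff_eq_pow_mul`; elementary: `2·v_p(k) ≤ 2^{v_p(k)} ≤ k`);
* `logTerm k = (−1)^{k+1} c_k w^k ω^k ∈ B⁰_max` with **`k · logTerm k = (−1)^{k+1} u^k`**
  (`natCast_mul_logTerm`) and `logSum N = Σ_{k=1}^{N} logTerm k` with
  **`N! · logSum N = Λ_N(u)`** (`factorial_mul_logSum`; `Λ_N = N!·L_N ∈ ℤ[X]` is the integral
  truncated logarithm `TruncatedLog.logTruncInt` of the tree, so that the congruences of `AinfLog`
  apply to `logSum`);
* `logSum_sub_logSum_mem` — the tail estimate `logSum N − logSum M ∈ p^m B⁰_max` for `2m ≤ M + 1`;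
* `tBmax : BmaxPlus F p` — **`t = log [ε] ∈ B_max⁺(F)`**, the class of the `p`-adic Cauchy sequence
  `n ↦ logSum (p^n − 1)` (`evalₐ_tBmax`).  (The truncation points `p^n − 1`, of maximal digit sum,
  are chosen for the sequel: `(p^n − 1)!` has `p`-adic valuation `(p^n − 1)/(p − 1) − n`, which is
  what makes the `N!`-normalised congruences of `AinfLog` converge `p`-adically, also for `p = 2`.)

* `galBmaxPlus_tBmax` — **`σ(t) = χ(σ)·t`**, and `frobBmaxPlus_tBmax` — **`φ(t) = p·t`** in `B_max⁺`
  (scalars written through `ainfToBmaxPlus`):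
  at level `n`, `N!·D_N ∈ ξ^{N+1}𝔸_inf` by the integral congruences of `AinfLog`
  (`Λ_N(σu) − χ(σ)Λ_N(u)`, `Λ_N([ε]^p − 1) − pΛ_N(u)`), and `mem_span_pow_of_factorial_mul_eq` turns this
  into `D_N ∈ p^n B⁰_max` using `v_p((p^n − 1)!) ≤ p^n − n` (`factorization_factorial_prime_pow_sub_one_le`).

Definitions: `logCoeff`, `uDivXi`, `omegaB`, `logTerm`, `logSum`, `tBmax`.  No named facts.

## References
* [BergerLaurent2002] L. Berger, *Représentations p-adiques et équations différentielles*,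
  Invent. Math. 148 (2002), §1.2 (p. 8 of arXiv:math/0102179).
* [FontaineAsterisque223III] J.-M. Fontaine, Astérisque 223 (1994), Exp. II §1.5.4 (`t = log[ε]`), §2.3.
-/

noncomputable section

open WittVector Field ValuativeRel Polynomial Finset
open scoped Nat

namespace Literature.NumberTheory.PAdicHodge

open Literature.NumberTheory.GaloisRepresentations
open Literature.NumberTheory.GaloisRepresentations.IsNonarchimedeanLocalField
open Literature.AlgebraicGeometry.Resolution
open TruncatedLog

/-! ### `p`-adic arithmetic: `c_k = p^k / k ∈ ℤ_p` -/

section PadicInt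

variable {p : ℕ} [Fact p.Prime]

/-- **`2 · v_p(k) ≤ k`** (`2v ≤ 2^v ≤ p^v ≤ k`). [folklore] -/
theorem two_mul_factorization_le (k : ℕ) : 2 * k.factorization p ≤ k := by
  -- `2v ≤ 2^v` (cf. `Literature.NumberTheory.EllipticCurves.two_mul_le_two_pow`, not imported here)
  have key : ∀ v : ℕ, 2 * v ≤ 2 ^ v := fun v => by
    induction v with
    | zero => simp
    | succ v ih =>
      rcases Nat.eq_zero_or_pos v with rfl | hv
      · simp
      · calc 2 * (v + 1) = 2 * v + 2 := by ring
          _ ≤ 2 ^ v + 2 ^ v := add_le_add ih (le_trans (by norm_num) (Nat.pow_le_pow_right (by norm_num) hv))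
          _ = 2 ^ (v + 1) := by ring
  rcases eq_or_ne k 0 with rfl | hk
  · simp
  · calc 2 * k.factorization p ≤ 2 ^ k.factorization p := key _
      _ ≤ p ^ k.factorization p := Nat.pow_le_pow_left (Nat.Prime.two_le Fact.out) _
      _ ≤ k := Nat.ordProj_le p hk

/-- **`k · d = p^e` is solvable in `ℤ_p` whenever `v_p(k) ≤ e`** (`k = p^v m`, `m ∈ ℤ_p^×`). [folklore] -/
theorem exists_natCast_mul_eq_pow {k e : ℕ} (hk : k ≠ 0) (he : k.factorization p ≤ e) :
    ∃ d : ℤ_[p], (k : ℤ_[p]) * d = (p : ℤ_[p]) ^ e := by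
  obtain ⟨u, hu⟩ := PadicCharacter.isUnit_natCast_of_not_dvd (p := p) (Nat.not_dvd_ordCompl Fact.out hk)
  have hkm : p ^ k.factorization p * (k / p ^ k.factorization p) = k := Nat.ordProj_mul_ordCompl_eq_self k p
  refine ⟨(p : ℤ_[p]) ^ (e - k.factorization p) * ((u⁻¹ : ℤ_[p]ˣ) : ℤ_[p]), ?_⟩
  calc (k : ℤ_[p]) * ((p : ℤ_[p]) ^ (e - k.factorization p) * ((u⁻¹ : ℤ_[p]ˣ) : ℤ_[p]))
      = ((p ^ k.factorization p * (k / p ^ k.factorization p) : ℕ) : ℤ_[p]) *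
          ((p : ℤ_[p]) ^ (e - k.factorization p) * ((u⁻¹ : ℤ_[p]ˣ) : ℤ_[p])) := by rw [hkm]
    _ = (p : ℤ_[p]) ^ k.factorization p * (p : ℤ_[p]) ^ (e - k.factorization p) *
          ((u : ℤ_[p]) * ((u⁻¹ : ℤ_[p]ˣ) : ℤ_[p])) := by rw [hu]; push_cast; ring
    _ = (p : ℤ_[p]) ^ e := by rw [← pow_add, Nat.add_sub_cancel' he, Units.mul_inv, mul_one]

variable (p) in
/-- **`c_k = p^k / k ∈ ℤ_p`** (`k ≥ 1`; `c_0 = 0`): the `p`-adic coefficient of `u^k/k = c_k w^k (ξ/p)^k`.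
[cite: BergerLaurent2002, §1.2] -/
def logCoeff (k : ℕ) : ℤ_[p] :=
  if hk : k = 0 then 0
  else Classical.choose (exists_natCast_mul_eq_pow hk
    (le_trans (Nat.le_mul_of_pos_left _ two_pos) (two_mul_factorization_le (p := p) k)))

/-- `k · c_k = p^k`. [folklore] -/
theorem natCast_mul_logCoeff {k : ℕ} (hk : k ≠ 0) : (k : ℤ_[p]) * logCoeff p k = (p : ℤ_[p]) ^ k := by
  rw [logCoeff, dif_neg hk]
  exact Classical.choose_spec (exists_natCast_mul_eq_pow hk
    (le_trans (Nat.le_mul_of_pos_left _ two_pos) (two_mul_factorization_le (p := p) k)))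

/-- **`c_k ∈ p^n ℤ_p` for `2n ≤ k`** (`v_p(c_k) = k − v_p(k) ≥ k/2`): the `p`-adic decay of the
coefficients of `log`. [folklore] -/
theorem exists_logCoeff_eq_pow_mul {k n : ℕ} (hk : k ≠ 0) (hn : 2 * n ≤ k) :
    ∃ d : ℤ_[p], logCoeff p k = (p : ℤ_[p]) ^ n * d := by
  have hv : k.factorization p ≤ k - n := by
    have := two_mul_factorization_le (p := p) k
    omega
  obtain ⟨d, hd⟩ := exists_natCast_mul_eq_pow hk hv
  refine ⟨d, mul_left_cancel₀ (Nat.cast_ne_zero.2 hk : (k : ℤ_[p]) ≠ 0) ?_⟩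
  rw [natCast_mul_logCoeff hk, mul_left_comm, hd, ← pow_add, Nat.add_sub_cancel' (by omega : n ≤ k)]

end PadicInt

/-! ### The terms `u^k/k` and partial sums of `log [ε]` in `B⁰_max` -/

variable {F : Type} [Field F] [ValuativeRel F] [TopologicalSpace F] [IsNonarchimedeanLocalField F]
  [CharZero F] {p : ℕ} [Fact p.Prime] [Fact (¬ IsUnit (p : integerC F))]
  [IsAdicComplete (Ideal.span {(p : integerC F)}) (integerC F)]

/-- `w ∈ 𝔸_inf` with `ξ w = u = [ε] − 1`. [cite: FontaineAsterisque223III, Exp. II §1.5.4] -/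
def uDivXi : Ainf (p := p) F := Classical.choose (xi_dvd_uAinf (F := F) (p := p))

/-- `ξ · w = u`. [folklore] -/
theorem xi_mul_uDivXi : (xi : Ainf (p := p) F) * uDivXi = uAinf :=
  (Classical.choose_spec (xi_dvd_uAinf (F := F) (p := p))).symm

omit [CharZero F] [IsAdicComplete (Ideal.span {(p : integerC F)}) (integerC F)] in
/-- `ω = ξ/p` as an element of `B⁰_max`. [folklore] -/
def omegaB : bmaxZero F p := ⟨xiDivP F p, xiDivP_mem_bmaxZero⟩

omit [CharZero F] [IsAdicComplete (Ideal.span {(p : integerC F)}) (integerC F)] in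
/-- `p · ω = ξ` in `B⁰_max`. [folklore] -/
theorem natCast_mul_omegaB :
    (p : bmaxZero F p) * omegaB = algebraMap (Ainf (p := p) F) (bmaxZero F p) xi :=
  Subtype.ext (by
    rw [Subalgebra.coe_mul]
    change ((p : bmaxZero F p) : Localization.Away (p : Ainf (p := p) F)) * xiDivP F p = _
    rw [show ((p : bmaxZero F p) : Localization.Away (p : Ainf (p := p) F)) =
        algebraMap (Ainf (p := p) F) (Localization.Away (p : Ainf (p := p) F)) p by
      rw [← map_natCast (algebraMap (Ainf (p := p) F) (bmaxZero F p)) p]; rfl]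
    exact algebraMap_natCast_mul_xiDivP)

/-- **The `k`-th term `(−1)^{k+1} u^k / k = (−1)^{k+1} c_k w^k ω^k ∈ B⁰_max`.** [cite: BergerLaurent2002, §1.2] -/
def logTerm (k : ℕ) : bmaxZero F p :=
  (-1) ^ (k + 1) * algebraMap (Ainf (p := p) F) (bmaxZero F p) (zpToAinf (logCoeff p k) * uDivXi ^ k) * omegaB ^ k

set_option maxHeartbeats 400000 in
/-- **`k · logTerm k = (−1)^{k+1} u^k`.** [folklore] -/
theorem natCast_mul_logTerm {k : ℕ} (hk : k ≠ 0) :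
    (k : bmaxZero F p) * logTerm k = (-1) ^ (k + 1) * algebraMap (Ainf (p := p) F) (bmaxZero F p) (uAinf ^ k) := by
  have h1 : (k : Ainf (p := p) F) * zpToAinf (logCoeff p k) = (p : Ainf (p := p) F) ^ k := by
    rw [← map_natCast (zpToAinf (F := F) (p := p)) k, ← map_mul, natCast_mul_logCoeff hk, map_pow, map_natCast]
  calc (k : bmaxZero F p) * logTerm k
      = (-1) ^ (k + 1) * algebraMap (Ainf (p := p) F) (bmaxZero F p) ((k : Ainf (p := p) F) * zpToAinf (logCoeff p k)) *
          algebraMap (Ainf (p := p) F) (bmaxZero F p) (uDivXi ^ k) * omegaB ^ k := by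
        simp only [logTerm, map_mul, map_natCast]; ring
    _ = (-1) ^ (k + 1) * ((p : bmaxZero F p) * omegaB) ^ k * algebraMap (Ainf (p := p) F) (bmaxZero F p) (uDivXi ^ k) := by
        rw [h1, map_pow, map_natCast]; ring
    _ = (-1) ^ (k + 1) * algebraMap (Ainf (p := p) F) (bmaxZero F p) (uAinf ^ k) := by
        rw [natCast_mul_omegaB, ← map_pow, mul_assoc, ← map_mul, ← mul_pow, xi_mul_uDivXi]

/-- **The partial sum `logSum N = Σ_{k=1}^{N} (−1)^{k+1} u^k/k ∈ B⁰_max`.** [cite: BergerLaurent2002, §1.2] -/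
def logSum (N : ℕ) : bmaxZero F p := ∑ k ∈ range N, logTerm (k + 1)

/-- **`N! · logSum N = Λ_N(u)`** with `Λ_N = N!·L_N ∈ ℤ[X]` (`TruncatedLog.logTruncInt`). [folklore] -/
theorem factorial_mul_logSum (N : ℕ) :
    (N ! : bmaxZero F p) * logSum N = algebraMap (Ainf (p := p) F) (bmaxZero F p) (aeval (uAinf : Ainf (p := p) F) (logTruncInt N)) := by
  simp only [logSum, logTruncInt, mul_sum, map_sum, _root_.map_mul, aeval_C, map_pow, aeval_X]
  refine sum_congr rfl fun m hm => ?_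
  have hmN : m + 1 ≤ N := Nat.succ_le_of_lt (mem_range.1 hm)
  have hdvd : m + 1 ∣ N ! := Nat.dvd_factorial (Nat.succ_pos m) hmN
  set q : ℕ := N ! / (m + 1) with hq
  have hfac : (N ! : bmaxZero F p) = (q : bmaxZero F p) * ((m + 1 : ℕ) : bmaxZero F p) := by
    rw [← Nat.cast_mul, hq, Nat.div_mul_cancel hdvd]
  rw [hfac, mul_assoc, natCast_mul_logTerm (k := m + 1) (Nat.succ_ne_zero m)]
  simp only [map_pow, map_neg, map_one, map_natCast]
  ring

/-! ### `p`-adic convergence -/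

/-- `logTerm k ∈ p^m B⁰_max` for `2m ≤ k`. [folklore] -/
theorem logTerm_mem_span_pow {k m : ℕ} (hk : k ≠ 0) (h : 2 * m ≤ k) :
    logTerm (F := F) (p := p) k ∈ Ideal.span {(p : bmaxZero F p)} ^ m := by
  obtain ⟨d, hd⟩ := exists_logCoeff_eq_pow_mul (p := p) hk h
  rw [Ideal.span_singleton_pow, Ideal.mem_span_singleton']
  refine ⟨(-1) ^ (k + 1) * algebraMap (Ainf (p := p) F) (bmaxZero F p) (zpToAinf d * uDivXi ^ k) * omegaB ^ k, ?_⟩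
  rw [logTerm, hd, map_mul zpToAinf, map_pow zpToAinf, map_natCast]
  simp only [map_mul, map_pow, map_natCast]
  ring

/-- **Tail estimate**: `logSum N − logSum M ∈ p^m B⁰_max` for `M ≤ N` and `2m ≤ M + 1`. [folklore] -/
theorem logSum_sub_logSum_mem {M N m : ℕ} (hMN : M ≤ N) (hM : 2 * m ≤ M + 1) :
    logSum (F := F) (p := p) N - logSum M ∈ Ideal.span {(p : bmaxZero F p)} ^ m := by
  have h : logSum (F := F) (p := p) N - logSum M = ∑ k ∈ Ico M N, logTerm (k + 1) := by
    simp only [logSum, range_eq_Ico]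
    rw [← sum_Ico_consecutive _ (Nat.zero_le M) hMN, add_sub_cancel_left]
  rw [h]
  exact Ideal.sum_mem _ fun k hk => logTerm_mem_span_pow (Nat.succ_ne_zero k) (by have := (mem_Ico.1 hk).1; omega)

/-- `2n ≤ p^n`. [folklore] -/
theorem two_mul_le_prime_pow (n : ℕ) : 2 * n ≤ p ^ n := by
  simpa [Nat.factorization_pow, Nat.Prime.factorization_self (Fact.out : p.Prime)] using
    two_mul_factorization_le (p := p) (p ^ n)

/-- **The partial sums `n ↦ logSum (p^n − 1)` form a `p`-adic Cauchy sequence in `B⁰_max`.**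
[cite: BergerLaurent2002, §1.2] -/
theorem isAdicCauchy_logSum :
    AdicCompletion.IsAdicCauchy (Ideal.span {(p : bmaxZero F p)}) (bmaxZero F p) fun n => logSum (p ^ n - 1) := by
  intro m n hmn
  rw [SModEq.sub_mem, smul_eq_mul, Ideal.mul_top, ← neg_sub]
  refine neg_mem (logSum_sub_logSum_mem ?_ ?_)
  · exact Nat.sub_le_sub_right (Nat.pow_le_pow_right (Nat.Prime.pos Fact.out) hmn) 1
  · rw [Nat.sub_add_cancel (Nat.one_le_pow _ _ (Nat.Prime.pos Fact.out))]
    exact two_mul_le_prime_pow m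

/-! ### `t = log [ε] ∈ B_max⁺` -/

/-- **Fontaine's `t = log [ε]` as an element of `B_max⁺(F)`**: the `p`-adic limit of the partial sums
`Σ_{k ≤ p^n − 1} (−1)^{k+1} u^k/k ∈ B⁰_max`. [cite: BergerLaurent2002, §1.2]
[cite: FontaineAsterisque223III, Exp. II §1.5.4] -/
def tBmax : BmaxPlus F p :=
  AdicCompletion.mk (Ideal.span {(p : bmaxZero F p)}) (bmaxZero F p) ⟨fun n => logSum (p ^ n - 1), isAdicCauchy_logSum⟩

/-- **`t mod p^n = logSum (p^n − 1) mod p^n`.** [folklore] -/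
theorem evalₐ_tBmax (n : ℕ) :
    AdicCompletion.evalₐ (Ideal.span {(p : bmaxZero F p)}) n (tBmax (F := F) (p := p)) =
      Ideal.Quotient.mk _ (logSum (p ^ n - 1)) :=
  AdicCompletion.evalₐ_mk _ _ _

omit [CharZero F] [IsAdicComplete (Ideal.span {(p : integerC F)}) (integerC F)] in
/-- `evalₐ` on the image of `𝔸_inf`. [folklore] -/
theorem evalₐ_ainfToBmaxPlus (n : ℕ) (x : Ainf (p := p) F) :
    AdicCompletion.evalₐ (Ideal.span {(p : bmaxZero F p)}) n (ainfToBmaxPlus F p x) =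
      Ideal.Quotient.mk _ (algebraMap (Ainf (p := p) F) (bmaxZero F p) x) :=
  AdicCompletion.evalₐ_of _ n _

set_option maxHeartbeats 1600000 in
/-- `σ(t) mod p^n = σ(logSum (p^n − 1)) mod p^n`.  (The rewriting along `evalₐ ∘ adicCompletionMap` is
slow to unify over the subalgebra `B⁰_max`, whence the raised heartbeat limit.) [folklore] -/
theorem evalₐ_galBmaxPlus_tBmax (σ : absoluteGaloisGroup F) (n : ℕ) :
    AdicCompletion.evalₐ (Ideal.span {(p : bmaxZero F p)}) n (galBmaxPlus σ (tBmax (F := F) (p := p))) =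
      Ideal.Quotient.mk _ (galBmaxZero σ (logSum (p ^ n - 1))) := by
  unfold galBmaxPlus
  rw [evalₐ_adicCompletionMap, evalₐ_tBmax, Ideal.quotientMap_mk]

set_option maxHeartbeats 1600000 in
omit [CharZero F] [IsAdicComplete (Ideal.span {(p : integerC F)}) (integerC F)] in
/-- `φ(x) mod p^n` for `x ∈ B_max⁺` given `x mod p^n`. [folklore] -/
theorem evalₐ_frobBmaxPlus_of_eq (n : ℕ) {x : BmaxPlus F p} {y : bmaxZero F p}
    (hx : AdicCompletion.evalₐ (Ideal.span {(p : bmaxZero F p)}) n x = Ideal.Quotient.mk _ y) :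
    AdicCompletion.evalₐ (Ideal.span {(p : bmaxZero F p)}) n (frobBmaxPlus F p x) =
      Ideal.Quotient.mk _ (frobBmaxZero F p y) := by
  unfold frobBmaxPlus
  rw [evalₐ_adicCompletionMap, hx, Ideal.quotientMap_mk]

set_option maxHeartbeats 1600000 in
/-- `(a · t) mod p^n` for `a ∈ 𝔸_inf`. [folklore] -/
theorem evalₐ_ainfToBmaxPlus_mul_tBmax (x : Ainf (p := p) F) (n : ℕ) :
    AdicCompletion.evalₐ (Ideal.span {(p : bmaxZero F p)}) n (ainfToBmaxPlus F p x * tBmax) =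
      Ideal.Quotient.mk _ (algebraMap (Ainf (p := p) F) (bmaxZero F p) x * logSum (p ^ n - 1)) := by
  rw [map_mul, evalₐ_tBmax, evalₐ_ainfToBmaxPlus, ← map_mul]

/-! ### The truncation points `p^n − 1`: `v_p((p^n − 1)!) ≤ p^n − n` -/

section Digits

variable {p : ℕ} [Fact p.Prime]

/-- The base-`p` digits of `p^n − 1` are `n` copies of `p − 1`. [folklore] -/
theorem digits_prime_pow_sub_one (n : ℕ) : Nat.digits p (p ^ n - 1) = List.replicate n (p - 1) := by
  have hp : 1 < p := Nat.Prime.one_lt Fact.out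
  induction n with
  | zero => simp
  | succ n ih =>
    have h : p ^ (n + 1) - 1 = (p - 1) + p * (p ^ n - 1) := by
      have h1 : 1 ≤ p ^ n := Nat.one_le_pow _ _ (by omega)
      have h2 : p * (p ^ n - 1) = p ^ (n + 1) - p := by rw [Nat.mul_sub, mul_one, ← pow_succ']
      have h3 : p ≤ p ^ (n + 1) := by
        calc p = p ^ 1 := (pow_one p).symm
          _ ≤ p ^ (n + 1) := Nat.pow_le_pow_right (by omega) (by omega)
      omega
    rw [h, Nat.digits_add p hp (p - 1) (p ^ n - 1) (Nat.sub_lt (by omega) one_pos) (Or.inl (by omega)), ih,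
      List.replicate_succ]

/-- **`v_p((p^n − 1)!) ≤ p^n − n`** (Legendre: `(p − 1)·v_p(N!) = N − s_p(N)` and `s_p(p^n − 1) = n(p − 1)`).
[folklore] -/
theorem factorization_factorial_prime_pow_sub_one_le (n : ℕ) :
    ((p ^ n - 1)!).factorization p ≤ p ^ n - n := by
  have hp : 1 < p := Nat.Prime.one_lt Fact.out
  have h := sub_one_mul_padicValNat_factorial (p := p) (p ^ n - 1)
  rw [digits_prime_pow_sub_one, List.sum_replicate, smul_eq_mul] at h
  rw [Nat.factorization_def _ Fact.out]
  have h1 : padicValNat p ((p ^ n - 1)!) ≤ (p - 1) * padicValNat p ((p ^ n - 1)!) :=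
    Nat.le_mul_of_pos_left _ (by omega)
  have h2 : n ≤ n * (p - 1) := Nat.le_mul_of_pos_right _ (by omega)
  omega

end Digits

/-! ### From `N!·D = ξ^{N+1} c` to `D ∈ p^n B⁰_max` (for `N = p^n − 1`) -/

omit [CharZero F] [IsAdicComplete (Ideal.span {(p : integerC F)}) (integerC F)] in
/-- `p` is a non-zero-divisor on `B⁰_max ⊆ 𝔸_inf[1/p]`. [folklore] -/
theorem eq_of_natCast_pow_mul_eq {v : ℕ} {y z : bmaxZero F p}
    (h : (p : bmaxZero F p) ^ v * y = (p : bmaxZero F p) ^ v * z) : y = z := by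
  have hu : IsUnit ((p : Localization.Away (p : Ainf (p := p) F)) ^ v) := by
    rw [← map_natCast (algebraMap (Ainf (p := p) F) (Localization.Away (p : Ainf (p := p) F))) p]
    exact (IsLocalization.Away.algebraMap_isUnit (p : Ainf (p := p) F)).pow v
  refine Subtype.ext (hu.mul_left_cancel ?_)
  have hp' : ((p : bmaxZero F p) : Localization.Away (p : Ainf (p := p) F)) = p := map_natCast (bmaxZero F p).val p
  have h' := congrArg (fun x : bmaxZero F p => (x : Localization.Away (p : Ainf (p := p) F))) h
  simp only [Subalgebra.coe_mul, Subalgebra.coe_pow, hp'] at h'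
  exact h'

omit [CharZero F] [IsAdicComplete (Ideal.span {(p : integerC F)}) (integerC F)] in
/-- `ξ^k c ↦ p^k ω^k c` in `B⁰_max`. [folklore] -/
theorem algebraMap_xi_pow_mul (k : ℕ) (c : Ainf (p := p) F) :
    algebraMap (Ainf (p := p) F) (bmaxZero F p) (xi ^ k * c) =
      (p : bmaxZero F p) ^ k * (omegaB ^ k * algebraMap (Ainf (p := p) F) (bmaxZero F p) c) := by
  rw [map_mul, map_pow, ← natCast_mul_omegaB, mul_pow, mul_assoc]

set_option maxHeartbeats 400000 in
omit [CharZero F] [IsAdicComplete (Ideal.span {(p : integerC F)}) (integerC F)] in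
/-- **The `p`-adic estimate**: if `(p^n − 1)! · D = ξ^{p^n} c` in `B⁰_max` then `D ∈ p^n B⁰_max`
(`(p^n − 1)! = p^v · unit` with `v ≤ p^n − n`, and `ξ^{p^n} = p^{p^n} ω^{p^n}`). [folklore] -/
theorem mem_span_pow_of_factorial_mul_eq {n : ℕ} {D : bmaxZero F p} {c : Ainf (p := p) F}
    (h : ((p ^ n - 1)! : bmaxZero F p) * D = algebraMap (Ainf (p := p) F) (bmaxZero F p) (xi ^ (p ^ n - 1 + 1) * c)) :
    D ∈ Ideal.span {(p : bmaxZero F p)} ^ n := by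
  set N : ℕ := p ^ n - 1 with hN
  have hN1 : N + 1 = p ^ n := Nat.sub_add_cancel (Nat.one_le_pow _ _ (Nat.Prime.pos Fact.out))
  set v : ℕ := (N !).factorization p with hv
  have hvle : v ≤ N + 1 - n := by
    rw [hN1]; exact factorization_factorial_prime_pow_sub_one_le n
  have hvN : v ≤ N + 1 := hvle.trans (Nat.sub_le _ _)
  -- `N! = p^v m` with `m` a unit
  have hNm : p ^ v * (N ! / p ^ v) = N ! := Nat.ordProj_mul_ordCompl_eq_self (N !) p
  obtain ⟨um, hum⟩ := PadicCharacter.isUnit_natCast_of_not_dvd (p := p) (Nat.not_dvd_ordCompl Fact.out (Nat.factorial_ne_zero N))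
  have hmB : IsUnit (((N ! / p ^ v : ℕ)) : bmaxZero F p) := by
    have := (um.isUnit.map ((algebraMap (Ainf (p := p) F) (bmaxZero F p)).comp zpToAinf))
    rwa [hum, map_natCast] at this
  obtain ⟨u, hu⟩ := hmB
  -- cancel `p^v`
  have key : (u : bmaxZero F p) * D =
      (p : bmaxZero F p) ^ (N + 1 - v) * (omegaB ^ (N + 1) * algebraMap (Ainf (p := p) F) (bmaxZero F p) c) := by
    refine eq_of_natCast_pow_mul_eq (v := v) ?_
    rw [← mul_assoc, ← mul_assoc, ← pow_add, Nat.add_sub_cancel' hvN, hu, ← Nat.cast_pow, ← Nat.cast_mul, hNm,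
      h, algebraMap_xi_pow_mul]
  have hD : D = ((u⁻¹ : (bmaxZero F p)ˣ) : bmaxZero F p) *
      ((p : bmaxZero F p) ^ (N + 1 - v) * (omegaB ^ (N + 1) * algebraMap (Ainf (p := p) F) (bmaxZero F p) c)) := by
    rw [← key, ← mul_assoc, Units.inv_mul, one_mul]
  rw [hD]
  have hn : n ≤ N + 1 := by rw [hN1]; exact (Nat.lt_pow_self (Nat.Prime.one_lt Fact.out)).le
  have hnle : n ≤ N + 1 - v := by omega
  have hmem : (p : bmaxZero F p) ^ (N + 1 - v) ∈ Ideal.span {(p : bmaxZero F p)} ^ (N + 1 - v) :=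
    Ideal.pow_mem_pow (Ideal.mem_span_singleton_self _) _
  exact Ideal.mul_mem_left _ _ (Ideal.pow_le_pow_right hnle (Ideal.mul_mem_right _ _ hmem))

/-! ### `σ(t) = χ(σ) · t` -/

/-- `σ` on `B⁰_max` extends `𝕎(σ♭)` on `𝔸_inf`. [folklore] -/
theorem galBmaxZero_algebraMap (σ : absoluteGaloisGroup F) (x : Ainf (p := p) F) :
    galBmaxZero σ (algebraMap (Ainf (p := p) F) (bmaxZero F p) x) =
      algebraMap (Ainf (p := p) F) (bmaxZero F p) (galAinf σ x) :=
  Subtype.ext (galAinfLoc_algebraMap σ x)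

omit [CharZero F] [IsAdicComplete (Ideal.span {(p : integerC F)}) (integerC F)] in
/-- `𝕎(σ♭)` commutes with evaluation of integer polynomials. [folklore] -/
theorem galAinf_aeval (σ : absoluteGaloisGroup F) (x : Ainf (p := p) F) (q : ℤ[X]) :
    galAinf σ (aeval x q) = aeval (galAinf σ x) q :=
  (aeval_algHom_apply ((galAinf (F := F) (p := p) σ).toIntAlgHom) x q).symm

/-- **The level-`n` congruence `σ(logSum N) ≡ χ(σ)·logSum N (mod p^n B⁰_max)`**, `N = p^n − 1`:
`N!·(σ(logSum N) − χ(σ)·logSum N) = Λ_N(σu) − χ(σ)Λ_N(u) ∈ ξ^{N+1}𝔸_inf`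
(`AinfLog.aeval_logTruncInt_galAinf_uAinf_sub_mem`) and `mem_span_pow_of_factorial_mul_eq`.
[cite: FontaineAsterisque223III, Exp. II §1.5.4] -/
theorem galBmaxZero_logSum_sub_mem (σ : absoluteGaloisGroup F) (n : ℕ) :
    galBmaxZero σ (logSum (p ^ n - 1)) - algebraMap (Ainf (p := p) F) (bmaxZero F p)
        (zpToAinf ((GaloisRep.cyclotomicCharacter F p σ : ℤ_[p]ˣ) : ℤ_[p])) * logSum (p ^ n - 1) ∈
      Ideal.span {(p : bmaxZero F p)} ^ n := by
  obtain ⟨c, hc⟩ := Ideal.mem_span_singleton'.1 (aeval_logTruncInt_galAinf_uAinf_sub_mem (F := F) (p := p) σ (p ^ n - 1))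
  refine mem_span_pow_of_factorial_mul_eq (c := c) ?_
  have h1 : ((p ^ n - 1)! : bmaxZero F p) * galBmaxZero σ (logSum (p ^ n - 1)) =
      algebraMap (Ainf (p := p) F) (bmaxZero F p) (aeval (galAinf σ uAinf) (logTruncInt (p ^ n - 1))) := by
    rw [← map_natCast (galBmaxZero (p := p) σ) ((p ^ n - 1)!), ← map_mul, factorial_mul_logSum, galBmaxZero_algebraMap,
      galAinf_aeval]
  have h2 : ((p ^ n - 1)! : bmaxZero F p) * (algebraMap (Ainf (p := p) F) (bmaxZero F p)
      (zpToAinf ((GaloisRep.cyclotomicCharacter F p σ : ℤ_[p]ˣ) : ℤ_[p])) * logSum (p ^ n - 1)) =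
      algebraMap (Ainf (p := p) F) (bmaxZero F p) (zpToAinf ((GaloisRep.cyclotomicCharacter F p σ : ℤ_[p]ˣ) : ℤ_[p]) *
        aeval uAinf (logTruncInt (p ^ n - 1))) := by
    rw [mul_left_comm, factorial_mul_logSum, ← map_mul]
  rw [mul_sub, h1, h2, ← map_sub, ← hc, mul_comm c]

set_option maxHeartbeats 1600000 in
/-- **`σ(t) = χ(σ) · t` in `B_max⁺(F)`** for every `σ ∈ Γ_F`, `χ` the cyclotomic character (checked modulo
every `p^n`, `galBmaxZero_logSum_sub_mem`). [cite: FontaineAsterisque223III, Exp. II §1.5.4]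
[cite: BergerLaurent2002, §1.2] -/
theorem galBmaxPlus_tBmax (σ : absoluteGaloisGroup F) :
    galBmaxPlus σ (tBmax (F := F) (p := p)) =
      ainfToBmaxPlus F p (zpToAinf ((GaloisRep.cyclotomicCharacter F p σ : ℤ_[p]ˣ) : ℤ_[p])) * tBmax := by
  refine AdicCompletion.ext_evalₐ fun n => ?_
  rw [evalₐ_galBmaxPlus_tBmax, evalₐ_ainfToBmaxPlus_mul_tBmax, Ideal.Quotient.mk_eq_mk_iff_sub_mem]
  exact galBmaxZero_logSum_sub_mem σ n

/-! ### `φ(t) = p · t` -/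

omit [CharZero F] [IsAdicComplete (Ideal.span {(p : integerC F)}) (integerC F)] in
/-- `φ[x] = [x]^p` on Teichmüller representatives. [folklore] -/
theorem frobenius_teichmuller (x : PreTilt (integerC F) p) :
    WittVector.frobenius (teichmuller p x : Ainf (p := p) F) = teichmuller p x ^ p := by
  rw [← map_pow]
  refine WittVector.ext fun k => ?_
  rw [coeff_frobenius_charP]
  rcases Nat.eq_zero_or_pos k with rfl | hk
  · rw [teichmuller_coeff_zero, teichmuller_coeff_zero]
  · rw [teichmuller_coeff_pos p _ k hk, teichmuller_coeff_pos p _ k hk, zero_pow (Nat.Prime.ne_zero Fact.out)]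

omit [IsAdicComplete (Ideal.span {(p : integerC F)}) (integerC F)] in
/-- `φ(u) = [ε]^p − 1`. [folklore] -/
theorem frobenius_uAinf :
    WittVector.frobenius (uAinf : Ainf (p := p) F) = teichmuller p (eps : PreTilt (integerC F) p) ^ p - 1 := by
  rw [uAinf_def, map_sub, frobenius_teichmuller, map_one]

omit [CharZero F] [IsAdicComplete (Ideal.span {(p : integerC F)}) (integerC F)] in
/-- `φ` on `B⁰_max` extends `φ` on `𝔸_inf`. [folklore] -/
theorem frobBmaxZero_algebraMap (x : Ainf (p := p) F) :
    frobBmaxZero F p (algebraMap (Ainf (p := p) F) (bmaxZero F p) x) =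
      algebraMap (Ainf (p := p) F) (bmaxZero F p) (WittVector.frobenius x) :=
  Subtype.ext (frobAinfLoc_algebraMap x)

omit [CharZero F] [IsAdicComplete (Ideal.span {(p : integerC F)}) (integerC F)] in
/-- `φ` commutes with evaluation of integer polynomials. [folklore] -/
theorem frobenius_aeval (x : Ainf (p := p) F) (q : ℤ[X]) :
    WittVector.frobenius (aeval x q) = aeval (WittVector.frobenius x) q :=
  (aeval_algHom_apply ((WittVector.frobenius : Ainf (p := p) F →+* Ainf (p := p) F).toIntAlgHom) x q).symm

/-- **The level-`n` congruence `φ(logSum N) ≡ p·logSum N (mod p^n B⁰_max)`**, `N = p^n − 1`: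
`N!·(φ(logSum N) − p·logSum N) = Λ_N([ε]^p − 1) − pΛ_N(u) ∈ ξ^{N+1}𝔸_inf`
(`AinfLog.aeval_logTruncInt_teichmuller_pow_sub_mem`). [cite: FontaineAsterisque223III, Exp. II §1.5.4] -/
theorem frobBmaxZero_logSum_sub_mem (n : ℕ) :
    frobBmaxZero F p (logSum (p ^ n - 1)) - (p : bmaxZero F p) * logSum (p ^ n - 1) ∈
      Ideal.span {(p : bmaxZero F p)} ^ n := by
  obtain ⟨c, hc⟩ := Ideal.mem_span_singleton'.1 (aeval_logTruncInt_teichmuller_pow_sub_mem (F := F) (p := p) p (p ^ n - 1))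
  refine mem_span_pow_of_factorial_mul_eq (c := c) ?_
  have h1 : ((p ^ n - 1)! : bmaxZero F p) * frobBmaxZero F p (logSum (p ^ n - 1)) =
      algebraMap (Ainf (p := p) F) (bmaxZero F p)
        (aeval (teichmuller p (eps : PreTilt (integerC F) p) ^ p - 1) (logTruncInt (p ^ n - 1))) := by
    rw [← map_natCast (frobBmaxZero F p) ((p ^ n - 1)!), ← map_mul, factorial_mul_logSum, frobBmaxZero_algebraMap,
      frobenius_aeval, frobenius_uAinf]
  have h2 : ((p ^ n - 1)! : bmaxZero F p) * ((p : bmaxZero F p) * logSum (p ^ n - 1)) =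
      algebraMap (Ainf (p := p) F) (bmaxZero F p) ((p : Ainf (p := p) F) * aeval uAinf (logTruncInt (p ^ n - 1))) := by
    rw [mul_left_comm, factorial_mul_logSum, map_mul, map_natCast]
  rw [mul_sub, h1, h2, ← map_sub, ← hc, mul_comm c]

set_option maxHeartbeats 1600000 in
/-- **`φ(t) = p · t` in `B_max⁺(F)`** (checked modulo every `p^n`, `frobBmaxZero_logSum_sub_mem`; the scalar
`p` is written through `ainfToBmaxPlus`). [cite: FontaineAsterisque223III, Exp. II §1.5.4]
[cite: BergerLaurent2002, §1.2] -/
theorem frobBmaxPlus_tBmax :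
    frobBmaxPlus F p (tBmax (F := F) (p := p)) = ainfToBmaxPlus F p (p : Ainf (p := p) F) * tBmax := by
  refine AdicCompletion.ext_evalₐ fun n => ?_
  rw [evalₐ_frobBmaxPlus_of_eq n (evalₐ_tBmax n), evalₐ_ainfToBmaxPlus_mul_tBmax, Ideal.Quotient.mk_eq_mk_iff_sub_mem,
    map_natCast]
  exact frobBmaxZero_logSum_sub_mem n


/-! ### Appendix (φ-road of line `kato_lever`, crux K★ `stmt-BirchSwinnertonDyer-22226`): `φ` fixes the `ℤ_p`-scalars -/

section PhiRoadLog

omit [CharZero F] [IsAdicComplete (Ideal.span {(p : integerC F)}) (integerC F)] in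
/-- **The Witt-vector Frobenius fixes `ℤ_p ⊂ 𝔸_inf(F)`**: `φ(zpToAinf c) = zpToAinf c` (coefficientwise: `φ` raises Witt coefficients
to the `p`-th power and commutes with `𝕎(𝔽_p → 𝒪♭)`, and `φ = id` on `𝕎(𝔽_p)`). [cite: FontaineOuyang2022, §4.4] -/
theorem frobenius_zpToAinf (c : ℤ_[p]) : WittVector.frobenius (zpToAinf c : Ainf (p := p) F) = zpToAinf c := by
  unfold zpToAinf
  simp only [RingHom.coe_comp, Function.comp_apply]
  refine WittVector.ext fun n => ?_
  rw [WittVector.coeff_frobenius_charP, WittVector.map_coeff, ← map_pow, ZMod.pow_card]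

omit [CharZero F] [IsAdicComplete (Ideal.span {(p : integerC F)}) (integerC F)] in
/-- **`φ` on `B⁰_max` fixes the structure map `ℤ_p → 𝔸_inf → B⁰_max`** — the hypothesis `φ ∘ ι = ι` of the generic `p`-adic
log-series theorems `Literature.RingTheory.FormalGroups.PadicLogSeries.*` for `B = B⁰_max`, `φ = frobBmaxZero`.
[cite: BergerLaurent2002, §1.2] -/
theorem frobBmaxZero_comp_algebraMap_comp_zpToAinf :
    (frobBmaxZero F p).comp ((algebraMap (Ainf (p := p) F) (bmaxZero F p)).comp zpToAinf) =
      (algebraMap (Ainf (p := p) F) (bmaxZero F p)).comp zpToAinf := by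
  refine RingHom.ext fun c => ?_
  simp only [RingHom.comp_apply]
  rw [frobBmaxZero_algebraMap, frobenius_zpToAinf]

end PhiRoadLog

end Literature.NumberTheory.PAdicHodge

end
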